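import Summits.ResolutionOfSingularities.ResolutionOfSingularities.Theorems.FrobeniusClosingPatchingRelPerfectDepthSNCPointwise
import Literature.AlgebraicGeometry.Resolution.SncSaturatedCentre
import HarnessLib

/-!
# Crux `PatchingRelPerfect` (stmt-ResolutionOfSingularities-16161), chain W5.2 — END-SNC support:
# `SNCWithAt` depends on the family only through the STALKS of its members at the point

[OURS · L1 W5.2 · rung tool] Replaces the role of NO printed item; NOT a statement of the manuscript under review; fact-free.
Bookkeeping for the X-side format of TargetsF5J (res-D-pv-052's `MixedFormatB`, DESIGN NOTE v2 a9a74dfd) and the pocket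
invariant (res-D-pv-009, `…DepthPocketInvariant.lean`): the format steps the host as a CONTROLLED transform
`σᶜ(𝓐, m)` while the pointwise transport (`…DepthSNCPointwiseTransport.lean`) produces the STRICT transform
`strictTransformIdeal σ Ĉ 𝓐`; at the points where the invariant is read the two have the same stalk, and simple normal
crossings at a point only see stalks:

* `SNCWithAt.of_stalk_eq` — if every member of `E′` through `x` is assigned, injectively, a member of `E` through `x` with the
  same stalk at `x`, then `SNCWithAt E C x → SNCWithAt E′ C x`;
* `SNCWithAt.centre_congr` — the centre may be replaced by one with the same stalk at `x`;
* `SNCWithAt.replace_head` — `SNCWithAt (A :: L) C x → stalkIdeal A′ x = stalkIdeal A x → SNCWithAt (A′ :: L) C x`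
  (for `A ∉ L`), the form used for the host member;
* `SNCWithAt.map_congr` — the same along a list map `E.map g` with stalk-preserving `g`.

## References
* E. Bierstone, D. Grigoriev, P. Milman, J. Włodarczyk, arXiv:1206.3090, Def. 3.1.1, Def. 3.1.3 (2).
  [BierstoneGrigorievMilmanWlodarczyk2011]
* J. Kollár, *Lectures on Resolution of Singularities* (2007), Def. 3.24. [Kollar2007]
-/

-- `Summit.<Summit>.<Sub>.Theorems` with `Sub = Summit` (single-conjunct summit, D-0017)
set_option linter.dupNamespace false

noncomputable section

open CategoryTheory CategoryTheory.Limits AlgebraicGeometry TopologicalSpace IsLocalRing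
open Literature.AlgebraicGeometry.Resolution

namespace Summit.ResolutionOfSingularities.ResolutionOfSingularities.Theorems

universe u

namespace DepthSNC

variable {X : Scheme.{u}} {E : List X.IdealSheafData} {C : X.IdealSheafData} {x : X}

/-- Ideal sheaves with the same stalk at `x` pass through `x` simultaneously (`mem_support_iff_stalkIdeal_ne_top`,
`SncSaturatedCentre.lean`). [folklore] -/
theorem mem_support_iff_of_stalkIdeal_eq {D D' : X.IdealSheafData} (h : stalkIdeal D' x = stalkIdeal D x) :
    x ∈ D'.support ↔ x ∈ D.support := by
  rw [mem_support_iff_stalkIdeal_ne_top, mem_support_iff_stalkIdeal_ne_top, h]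

/-- [OURS · L1 W5.2] **`SNCWithAt` only sees stalks**: if every member of `E′` through `x` is assigned, injectively, a member
of `E` through `x` with the same stalk at `x`, then simple normal crossings of `E` (with `C`) at `x` give the same for `E′`.
[cite: BierstoneGrigorievMilmanWlodarczyk2011, Def. 3.1.1] -/
theorem SNCWithAt.of_stalk_eq (h : SNCWithAt E C x) {E' : List X.IdealSheafData}
    (f : {D' : X.IdealSheafData // D' ∈ E' ∧ x ∈ D'.support} → {D : X.IdealSheafData // D ∈ E ∧ x ∈ D.support})
    (hf : Function.Injective f) (hstalk : ∀ D', stalkIdeal D'.1 x = stalkIdeal (f D').1 x) :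
    SNCWithAt E' C x := by
  obtain ⟨hreg, d, v, hd, hv, ⟨ι, hι, hιD⟩, hC⟩ := h
  refine ⟨hreg, d, v, hd, hv, ⟨fun D' => ι (f D'), hι.comp hf, fun D' => ?_⟩, hC⟩
  rw [hstalk D', hιD (f D')]

/-- [OURS · L1 W5.2] **Change of centre with the same stalk** at `x` (and `x ∈ V(C′) → x ∈ V(C)`, automatic). [folklore] -/
theorem SNCWithAt.centre_congr (h : SNCWithAt E C x) {C' : X.IdealSheafData}
    (hC' : stalkIdeal C' x = stalkIdeal C x) : SNCWithAt E C' x := by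
  obtain ⟨hreg, d, v, hd, hv, hι, hC⟩ := h
  refine ⟨hreg, d, v, hd, hv, hι, fun hx => ?_⟩
  obtain ⟨S, hS⟩ := hC ((mem_support_iff_of_stalkIdeal_eq hC').mp hx)
  exact ⟨S, by rw [hC', hS]⟩

/-- [OURS · L1 W5.2] **Replacing the head member by an ideal sheaf with the same stalk at `x`** (host member: controlled vs.
strict transform), for a head not repeated in the tail. [cite: BierstoneGrigorievMilmanWlodarczyk2011, Def. 3.1.1] -/
theorem SNCWithAt.replace_head {A A' : X.IdealSheafData} {L : List X.IdealSheafData} (h : SNCWithAt (A :: L) C x)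
    (hA : A ∉ L) (hst : stalkIdeal A' x = stalkIdeal A x) : SNCWithAt (A' :: L) C x := by
  classical
  -- the assignment: `A′ ↦ A`, tail members to themselves
  have hmemA : x ∈ A'.support → x ∈ A.support := (mem_support_iff_of_stalkIdeal_eq hst).mp
  let f : {D' : X.IdealSheafData // D' ∈ A' :: L ∧ x ∈ D'.support} →
      {D : X.IdealSheafData // D ∈ A :: L ∧ x ∈ D.support} := fun D' =>
    if hD : D'.1 = A' then ⟨A, List.mem_cons_self, hmemA (hD ▸ D'.2.2)⟩
    else ⟨D'.1, List.mem_cons_of_mem _ ((List.mem_cons.mp D'.2.1).resolve_left hD), D'.2.2⟩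
  have hf_val : ∀ D', (f D').1 = if D'.1 = A' then A else D'.1 := by
    intro D'
    by_cases hD : D'.1 = A'
    · simp only [f, dif_pos hD, if_pos hD]
    · simp only [f, dif_neg hD, if_neg hD]
  refine h.of_stalk_eq f ?_ ?_
  · intro D₁ D₂ heq
    have hv := congrArg Subtype.val heq
    rw [hf_val, hf_val] at hv
    apply Subtype.ext
    by_cases h₁ : D₁.1 = A' <;> by_cases h₂ : D₂.1 = A'
    · rw [h₁, h₂]
    · exfalso
      rw [if_pos h₁, if_neg h₂] at hv
      -- `A = D₂.1 ∈ L` contradicts `A ∉ L`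
      have hD₂L : D₂.1 ∈ L := ((List.mem_cons.mp D₂.2.1).resolve_left h₂)
      exact hA (hv ▸ hD₂L)
    · exfalso
      rw [if_neg h₁, if_pos h₂] at hv
      have hD₁L : D₁.1 ∈ L := ((List.mem_cons.mp D₁.2.1).resolve_left h₁)
      exact hA (hv ▸ hD₁L)
    · rw [if_neg h₁, if_neg h₂] at hv
      exact hv
  · intro D'
    rw [hf_val]
    by_cases hD : D'.1 = A'
    · rw [if_pos hD, hD, hst]
    · rw [if_neg hD]

/-- [OURS · L1 W5.2] **Replacing every member by a stalk-equal one, along a list map** (`E′ = E.map g` with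
`(g D)_x = D_x` for the members through `x`; no injectivity of `g` is needed: the assignment picks preimages). [folklore] -/
theorem SNCWithAt.map_congr (h : SNCWithAt E C x) (g : X.IdealSheafData → X.IdealSheafData)
    (hg : ∀ D ∈ E, x ∈ (g D).support → stalkIdeal (g D) x = stalkIdeal D x) :
    SNCWithAt (E.map g) C x := by
  classical
  have key : ∀ D' : {D' : X.IdealSheafData // D' ∈ E.map g ∧ x ∈ D'.support},
      ∃ D : {D : X.IdealSheafData // D ∈ E ∧ x ∈ D.support}, g D.1 = D'.1 := by
    rintro ⟨D', hD', hx'⟩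
    obtain ⟨D, hD, rfl⟩ := List.mem_map.mp hD'
    exact ⟨⟨D, hD, (mem_support_iff_of_stalkIdeal_eq (hg D hD hx')).mp hx'⟩, rfl⟩
  choose f hf using key
  refine h.of_stalk_eq f ?_ ?_
  · intro D₁ D₂ heq
    apply Subtype.ext
    rw [← hf D₁, ← hf D₂, heq]
  · intro D'
    have hx' : x ∈ (g (f D').1).support := by rw [hf D']; exact D'.2.2
    rw [← hg (f D').1 (f D').2.1 hx', hf D']

end DepthSNC

end Summit.ResolutionOfSingularities.ResolutionOfSingularities.Theorems

end
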